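import Summits.HodgeConjecture.HodgeCM.PerL34.ArchC_1

/-! PORT of `HodgeCM/PerL34/ArchC.lean` (HodgeCMPerL run 82) — part 2: continuation of `Summits.HodgeConjecture.HodgeCM.PerL34.ArchC_1` (split at a top-level declaration boundary by port_pkg.py; scope re-opened below; declarations unchanged). -/

-- port_pkg: scope re-opened for this part (file-level context, then the namespace/section stack open at the cut)
set_option autoImplicit false
noncomputable section
namespace HodgeCM
namespace PerL34.ArchC
open HodgeCM.Prior.Perl34File HodgeCM.Prior.Perl34File.Perl34
local notation "⟪" x ", " y "⟫" => @inner ℂ _ _ x y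
section LayerC
variable {H HG CG G SK SigIdx SigIdxG : Type*}
variable [NormedAddCommGroup H] [InnerProductSpace ℂ H] [CompleteSpace H]
variable [NormedAddCommGroup HG] [InnerProductSpace ℂ HG] [CompleteSpace HG]
variable [NormedAddCommGroup CG] [NormedSpace ℂ CG]
variable [Group G] [TopologicalSpace G] [TopologicalSpace SK]
namespace ArchCDatum
variable {C : IsolationCore H HG CG G SK SigIdx SigIdxG} {D : TorusData C} {P : C4a.PointedCore C}
variable (A : ArchCDatum C D P)
/-- **Lemma 4.1(c), semantic form** ([PerL] v5 ll. 488–490 with ll. 387–390; proof ll. 513–523):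
if 𝒯_Φ|_{σ̂} ≠ 0 for some Φ ∈ 𝒮^κ then σ̂ contains a non-zero vector y with R(t)y = w(t)y for all
t ∈ T(L₀⊗ℝ). -/
theorem exists_eigenvector (Φ : SK) (i : SigIdx) (h : ∃ v ∈ C.hatσ i, C.TΦ Φ v ≠ 0) :
    ∃ y ∈ C.hatσ i, y ≠ 0 ∧ ∀ t : A.Tg, C.R (A.ιT t) y = A.w t • y := by
  obtain ⟨v, hv, hTv⟩ := h
  -- L² nonvanishing → sup-norm nonvanishing → a point (l. 514 "for some g")
  obtain ⟨p, hp⟩ := C4a.exists_evalPt_ne_zero C P (C4a.TΦc_ne_zero C hTv)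
  -- ll. 514–518: the functional l = 𝒯_{φ⁰⊗Φ_f}(·)(p) is non-zero on (a smooth vector of) σ̂
  obtain ⟨f, v₁, hv₁, hl⟩ := A.exists_smooth_ne_zero Φ i p v hv hp
  -- ll. 518–523: Layer A with ρ = R ∘ ιT, S = σ̂_i, e = e_σ̂, l = pointFunctional
  have key := exists_eigenvector_of_covariant_functional (C.R.comp A.ιT)
    (fun t u u' => C.R_unitary (A.ιT t) u u') A.w A.w_norm (C.hatσ i)
    (fun t u hu => C.hatσ_invariant i (A.ιT t) u hu) (C.eσ i) (C.eσ_mem i) (C.eσ_fix i)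
    (C.eσ_selfAdjoint i) (C4a.pointFunctional C P (A.ins f A.φ₀) p)
    (fun t u => A.covariant f p t u) (A.Sm_sub i hv₁) hl
  simpa only [MonoidHom.coe_comp, Function.comp_apply] using key

/-- **Lemma 4.1(c) as consumed by Thm 3.7** — verbatim the shape of the frozen
`IsolationSetting.H_occ12` / `H_occ34` (tex ll. 442–443, the (†)) and of prl1's `ThetaModel.Open_occ`:
"for every isotypic component σ̂ and Φ ∈ 𝒮^κ with 𝒯_Φ|_{σ̂} ≠ 0 the type w occurs in σ_∞|_T". -/
theorem H_occ (A : ArchCDatum C D P) :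
    ∀ (Φ : SK) (i : SigIdx), (∃ v ∈ C.hatσ i, C.TΦ Φ v ≠ 0) → D.wOccurs i :=
  fun Φ i h => A.wOccurs_of_eigenvector i (A.exists_eigenvector Φ i h)

/-- The Prior C4a package recovered: an `ArchCDatum` yields an `OccDischarge`-free discharge; for
comparison with the Prior capstone we also assemble the full frozen `IsolationSetting` from two
`CharsDischarge`s (Lemma 4.2(b), Prior C4) and two `ArchCDatum`s (this file). -/
def mkIsolationSetting (tA tB : TorusData C) {V₁ V₂ : Type} (P : C4a.PointedCore C)
    (chA : C4.CharsDischarge tA V₁) (chB : C4.CharsDischarge tB V₂)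
    (aA : ArchCDatum C tA P) (aB : ArchCDatum C tB P) :
    IsolationSetting H HG CG G SK SigIdx SigIdxG where
  core := C
  t12 := tA
  t34 := tB
  H_chars12 := chA.H_chars
  H_chars34 := chB.H_chars
  H_occ12 := aA.H_occ
  H_occ34 := aB.H_occ

end ArchCDatum

end LayerC

end PerL34.ArchC

/-! ## The prl1-level corollary: `ThetaModel.Open_occ` (input A10, formerly `Open_occ`) from per-context Lemma 4.1(c) data -/

namespace Universe.ThetaModel

open HodgeCM.Prior.Perl34File HodgeCM.Prior.Perl34File.Perl34 HodgeCM.PerL34.ArchC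

/-- prl1's open input A10 `Open_occ` (package ≥ 03:32Z; formerly `Open_occ`) = both halves of H_occ in
every good seesaw context, from a Lemma-4.1(c) datum on each torus side of each context. -/
theorem Open_occ_of_archC {U : Universe} (T : U.ThetaModel)
    (Pc : ∀ {L : CMField} {ι₁ : L →+* ℂ} (V : HermSpace3 L ι₁) (c : SeesawCtx L),
      C4a.PointedCore (T.core V c))
    (A12 : ∀ {L : CMField} {ι₁ : L →+* ℂ} (V : HermSpace3 L ι₁) (c : SeesawCtx L),
      T.GoodCtx ι₁ c → Nonempty (ArchCDatum (T.core V c) (T.t12 V c) (Pc V c)))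
    (A34 : ∀ {L : CMField} {ι₁ : L →+* ℂ} (V : HermSpace3 L ι₁) (c : SeesawCtx L),
      T.GoodCtx ι₁ c → Nonempty (ArchCDatum (T.core V c) (T.t34 V c) (Pc V c))) :
    T.Open_occ := by
  intro L ι₁ V c hc
  obtain ⟨a⟩ := A12 V c hc
  obtain ⟨b⟩ := A34 V c hc
  exact ⟨a.H_occ, b.H_occ⟩

end Universe.ThetaModel

end HodgeCM

end
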